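import Literature.NumberTheory.EllipticCurves.ModularParamFormalLogProofs
import HarnessLib

/-!
# The `x`-coordinate along the modular parametrisation: `b·X_E(z(q)) = z(q)²·a`
# (the `(x, y)`-dictionary for the local parameter `z`; proofs only)

Topic `NumberTheory/EllipticCurves`; a proofs-only file (theorems only, no definitions, no named
facts). Sequel of `ModularParamFormalLogProofs`. There, for `f ∈ S₂(Γ₀(N))`, a lattice
`Λ ⊇ Λ_f` with `(g₂, g₃) = (−4a₄, −4a₆)` and a presentation `x = a/b` of `x = ℘_Λ(2πi∫f)` by cusp
forms, the local parameter `z = −X/Y` of `E : Y² = X³ + a₄X + a₆` along `τ ↦ (X(τ), Y(τ))` is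
constructed (`z·(bθa − aθb) = −2abe`) and `log_E(z(q)) = Σ aₙqⁿ/n` is proved; Step 4 of that
proof is the identity **`b·X_E(z(q)) = z(q)²·a`** for the pole-cleared formal `x`-coordinate
`X_E = z²x(z) = formalXMulSq` of `Ê` — i.e. the `x`-coordinate of the formal point of parameter
`z(q)` IS the modular function `x = a/b`. This file EXPORTS that identity
(`mul_formalXMulSq_subst_eq_of_ode`, same hypotheses, same proof) and its modular wrapper
(`IsXPresentation.exists_formalLog_subst_eq_and_formalXMulSq`: one `z` with `z·y = −2x`,
`log_E(z) = Σ aₙqⁿ/n` AND `b·X_E(z) = z²a`). With `w = z³/X_E(z)` (`formalXMulSq_mul_formalW`)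
it gives `w(z(q)) = z(q)·b/a`: the `w`-coordinate, hence the parameter `θ_C(z)` of ANY `ℚ`-model
`C • E`, lies in `Frac ℤ⟦q⟧` as soon as `z` does — the modular input of the finite-height route to
the integrality of the Manin constant at the primes `p = 2, 3` (`NeronIsogenyScaling.lean`, "A
finite-height refinement", bullet (m4): "the `x, y`-dictionary for `z_L`").

## References

* T. Honda, *On the theory of commutative formal groups*, J. Math. Soc. Japan 22 (1970), §6.2,
  pp. 241–242. [Honda1970]
* J. E. Cremona, *Algorithms for modular elliptic curves*, 2nd ed. (1997), §2.10. [CremonaAlgorithms1997]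
* J. H. Silverman, *The Arithmetic of Elliptic Curves*, 2nd ed. (2009), IV.1 (`z = −x/y`,
  `x(z) = z/w(z)`). [SilvermanAEC2009]
-/

noncomputable section

open Complex Filter Topology Set Function PowerSeries
open UpperHalfPlane hiding I
open scoped Real Topology Manifold MatrixGroups PeriodPair ModularForm WithZero
open ModularForm CongruenceSubgroup

open Literature.NumberTheory.EllipticCurves

namespace Literature.NumberTheory.EllipticCurves.ModularForms

/-! ### The core identity: `b·X_E(z) = z²·a` from the cleared Weierstrass equation -/

section Core

/-- **`b·X_E(z(q)) = z(q)²·a`, formal version.** Let `a, b, e ∈ ℂ⟦q⟧` be nonzero with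
`a(0) = e(0) = 0`, `ord a < ord b`, satisfying the cleared Weierstrass equation
`(bθa − aθb)² = 4e²b(a³ + a₄ab² + a₆b³)` (`θ = q d/dq`), and let `z ∈ ℂ⟦q⟧` with
`z·(bθa − aθb) = −2abe` (the local parameter `−X/Y` of `E : Y² = X³ + a₄X + a₆`). Then the
pole-cleared formal `x`-coordinate `X_E = z²x(z)` (`formalXMulSq`) satisfies `b·X_E(z) = z²·a`:
both `X_E(z)` and `z²a/b` solve `T² = T³ + a₄z⁴T + a₆z⁶` with `T(0) = 1`, whose solution is
unique (Step 4 of `formalLog_subst_eq_of_ode`, exported). [cite: Honda1970, §6.2 (pp. 241–242)]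
[cite: CremonaAlgorithms1997, §2.10] -/
theorem mul_formalXMulSq_subst_eq_of_ode (a₄ a₆ : ℂ) {a b e z : ℂ⟦X⟧} (ha : a ≠ 0) (hb : b ≠ 0)
    (he : e ≠ 0) (ha0 : constantCoeff a = 0) (he0 : constantCoeff e = 0)
    (hord : a.order.toNat < b.order.toNat)
    (hode : (b * thetaPS a - a * thetaPS b) ^ 2 =
      4 * e ^ 2 * b * (a ^ 3 + C a₄ * a * b ^ 2 + C a₆ * b ^ 3))
    (hz : z * (b * thetaPS a - a * thetaPS b) = -2 * a * b * e) :
    b * ({ a₁ := 0, a₂ := 0, a₃ := 0, a₄ := a₄, a₆ := a₆ } : WeierstrassCurve ℂ).formalXMulSq.subst z =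
      z ^ 2 * a := by
  set W : WeierstrassCurve ℂ := { a₁ := 0, a₂ := 0, a₃ := 0, a₄ := a₄, a₆ := a₆ } with hW
  -- Step 0: factor out the orders
  obtain ⟨A, hA0, haA⟩ := exists_eq_X_pow_mul ha
  obtain ⟨B, hB0, hbB⟩ := exists_eq_X_pow_mul hb
  obtain ⟨E, hE0, heE⟩ := exists_eq_X_pow_mul he
  set ma := a.order.toNat with hma
  set mb := b.order.toNat with hmb
  set me := e.order.toNat with hme
  have hma1 : 1 ≤ ma := one_le_order_toNat ha ha0
  have hme1 : 1 ≤ me := one_le_order_toNat he he0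
  obtain ⟨d, hd⟩ : ∃ d, mb = ma + d + 1 := Nat.exists_eq_add_of_lt hord
  -- `θa = X^{ma}(ma A + θA)` etc., and `D = X^{ma+mb} D̃`
  set Dt := B * ((ma : ℂ⟦X⟧) * A + thetaPS A) - A * ((mb : ℂ⟦X⟧) * B + thetaPS B) with hDt
  clear_value Dt
  have hD : b * thetaPS a - a * thetaPS b = PowerSeries.X ^ (ma + mb) * Dt := by
    rw [haA, hbB, thetaPS_X_pow_mul, thetaPS_X_pow_mul, hDt]; ring
  have hDt0 : constantCoeff Dt ≠ 0 := by
    have hne : (ma : ℂ) ≠ mb := by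
      intro h; have := (Nat.cast_injective h : ma = mb); omega
    rw [hDt]
    simp only [map_sub, map_mul, map_add, map_natCast, constantCoeff_thetaPS, add_zero]
    intro h
    apply hne
    have h' : ((ma : ℂ) - mb) * (constantCoeff A * constantCoeff B) = 0 := by
      linear_combination h
    rcases mul_eq_zero.mp h' with h1 | h1
    · exact (sub_eq_zero.mp h1)
    · exact absurd h1 (mul_ne_zero hA0 hB0)
  -- Step 1: the ODE compares `X^{2ma+2mb} D̃²` with `X^{2me+mb+3ma}·4E²B·C̃`
  set Ct := A ^ 3 + C a₄ * PowerSeries.X ^ (2 * (d + 1)) * A * B ^ 2 +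
    C a₆ * PowerSeries.X ^ (3 * (d + 1)) * B ^ 3 with hCt
  clear_value Ct
  have hCt0 : constantCoeff Ct ≠ 0 := by
    rw [hCt]
    simp only [map_add, map_mul, map_pow, constantCoeff_C, constantCoeff_X, ne_eq]
    rw [zero_pow (by omega), zero_pow (by omega)]
    simpa using pow_ne_zero 3 hA0
  have hcubic : a ^ 3 + C a₄ * a * b ^ 2 + C a₆ * b ^ 3 = PowerSeries.X ^ (3 * ma) * Ct := by
    rw [haA, hbB, hCt, hd]; ring
  have hode' : PowerSeries.X ^ (2 * (ma + mb)) * Dt ^ 2 =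
      PowerSeries.X ^ (2 * me + mb + 3 * ma) * (4 * E ^ 2 * B * Ct) := by
    have := hode
    rw [hD, hcubic, heE, hbB] at this
    linear_combination this
  have hunits1 : constantCoeff (Dt ^ 2) ≠ 0 := by rw [map_pow]; exact pow_ne_zero 2 hDt0
  have hunits2 : constantCoeff (4 * E ^ 2 * B * Ct) ≠ 0 := by
    simp only [map_mul, map_pow, map_ofNat]
    exact mul_ne_zero (mul_ne_zero (mul_ne_zero (by norm_num) (pow_ne_zero 2 hE0)) hB0) hCt0
  have hexp : 2 * (ma + mb) = 2 * me + mb + 3 * ma := eq_of_X_pow_mul_eq_X_pow_mul hunits1 hunits2 hode'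
  have hDt2 : Dt ^ 2 = 4 * E ^ 2 * B * Ct := eq_of_X_pow_mul_eq_X_pow_mul' hunits1 hunits2 hode'
  -- hence `mb = ma + 2me`, i.e. `d + 1 = 2 me`
  have hd2 : d + 1 = 2 * me := by omega
  -- Step 2: `z = X^{me} Z̃` with `Z̃ D̃ = −2ABE`
  set Zt := -2 * A * B * E * Dt⁻¹ with hZt
  clear_value Zt
  have hZD : Zt * Dt = -2 * A * B * E := by
    rw [hZt, mul_assoc, PowerSeries.inv_mul_cancel _ hDt0, mul_one]
  have hzZ : z = PowerSeries.X ^ me * Zt := by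
    have h1 : PowerSeries.X ^ (ma + mb) * (z * Dt) =
        PowerSeries.X ^ (ma + mb) * (PowerSeries.X ^ me * Zt * Dt) := by
      have := hz
      rw [hD, haA, hbB, heE] at this
      linear_combination this - PowerSeries.X ^ (ma + mb) * PowerSeries.X ^ me * hZD
    have h2 : z * Dt = PowerSeries.X ^ me * Zt * Dt := X_pow_mul_cancel h1
    have hDtne : Dt ≠ 0 := fun h ↦ hDt0 (by rw [h, map_zero])
    exact mul_right_cancel₀ hDtne h2
  have hz0 : constantCoeff z = 0 := by
    rw [hzZ, map_mul, map_pow, constantCoeff_X, zero_pow (by omega), zero_mul]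
  have hzs : HasSubst z := HasSubst.of_constantCoeff_zero' hz0
  -- Step 3: the `(QC)` relation `Z̃² C̃ = A² B`
  have hQC : Zt ^ 2 * Ct = A ^ 2 * B := by
    have hEBC : 4 * E ^ 2 * B * Ct ≠ 0 := fun h ↦ hunits2 (by rw [h, map_zero])
    have key : (Zt ^ 2 * Ct - A ^ 2 * B) * (4 * E ^ 2 * B * Ct) = 0 := by
      linear_combination (-Ct * Zt ^ 2) * hDt2 + Ct * (Zt * Dt - 2 * A * B * E) * hZD
    exact sub_eq_zero.mp ((mul_eq_zero.mp key).resolve_right hEBC)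
  -- Step 4: `b·X_E(z) = z²·a`
  set P := W.formalXMulSq.subst z with hP
  clear_value P
  have hP0 : constantCoeff P = 1 := by
    rw [hP, constantCoeff_subst_of_zero hz0, WeierstrassCurve.constantCoeff_formalXMulSq]
  have hPeq : P ^ 2 = P ^ 3 + C a₄ * z ^ 4 * P + C a₆ * z ^ 6 := by
    have h := W.formalXMulSq_sq_eq
    have h1 : W.a₁ = 0 := rfl
    have h2 : W.a₂ = 0 := rfl
    have h3 : W.a₃ = 0 := rfl
    have h4 : W.a₄ = a₄ := rfl
    have h6 : W.a₆ = a₆ := rfl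
    rw [h1, h2, h3, h4, h6, map_zero] at h
    simp only [zero_mul, add_zero] at h
    have h' := congrArg (PowerSeries.subst z) h
    simp only [subst_pow hzs, subst_add hzs, subst_mul hzs, subst_X hzs, subst_C' hzs] at h'
    rw [hP]
    linear_combination h'
  set Q := Zt ^ 2 * A * B⁻¹ with hQ
  clear_value Q
  have hBinv : B * B⁻¹ = 1 := PowerSeries.mul_inv_cancel _ hB0
  have hBQ : B * Q = Zt ^ 2 * A := by
    rw [hQ]; linear_combination Zt ^ 2 * A * hBinv
  have hQ0 : constantCoeff Q = 1 := by
    have hγ : constantCoeff Ct = constantCoeff A ^ 3 := by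
      rw [hCt]
      simp only [map_add, map_mul, map_pow, constantCoeff_C, constantCoeff_X]
      rw [zero_pow (by omega), zero_pow (by omega)]
      ring
    have h1 := congrArg constantCoeff hBQ
    have h2 := congrArg constantCoeff hQC
    simp only [map_mul, map_pow] at h1 h2
    rw [hγ] at h2
    -- `h2 : ζ² α³ = α² β`, `h1 : β·Q(0) = ζ² α`
    have h3 : constantCoeff Zt ^ 2 * constantCoeff A = constantCoeff B := by
      have : (constantCoeff Zt ^ 2 * constantCoeff A - constantCoeff B) * constantCoeff A ^ 2 = 0 := by
        linear_combination h2
      exact sub_eq_zero.mp ((mul_eq_zero.mp this).resolve_right (pow_ne_zero 2 hA0))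
    rw [h3] at h1
    refine mul_left_cancel₀ hB0 ?_
    rw [mul_one]
    exact h1
  have hQeq : Q ^ 2 = Q ^ 3 + C a₄ * z ^ 4 * Q + C a₆ * z ^ 6 := by
    have hB3 : B ^ 3 ≠ 0 := pow_ne_zero 3 (fun h ↦ hB0 (by rw [h, map_zero]))
    have key : B ^ 3 * (Q ^ 2 - (Q ^ 3 + C a₄ * z ^ 4 * Q + C a₆ * z ^ 6)) = 0 := by
      rw [hzZ]
      have hCt' : Ct = A ^ 3 + C a₄ * PowerSeries.X ^ (4 * me) * A * B ^ 2 +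
          C a₆ * PowerSeries.X ^ (6 * me) * B ^ 3 := by
        rw [hCt, hd2]; ring_nf
      linear_combination (B * (B * Q + Zt ^ 2 * A) - ((B * Q) ^ 2 + B * Q * Zt ^ 2 * A + Zt ^ 4 * A ^ 2) -
        C a₄ * (PowerSeries.X ^ me * Zt) ^ 4 * B ^ 2) * hBQ - Zt ^ 4 * hQC + Zt ^ 6 * hCt'
    exact sub_eq_zero.mp ((mul_eq_zero.mp key).resolve_left hB3)
  have hPQ : P = Q := eq_of_sq_eq_cube a₄ a₆ hz0 hP0 hQ0 hPeq hQeq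
  have hF3 : b * P = z ^ 2 * a := by
    have hmb2 : mb = ma + 2 * me := by omega
    rw [hPQ, hbB, hzZ, haA, hmb2, mul_assoc, hBQ]; ring
  exact hF3

end Core

/-! ### The modular wrapper -/

section Modular

variable {N : ℕ} [NeZero N] {k : ℤ}

namespace IsXPresentation

variable {f : CuspForm (Gamma0 N) 2} {L : PeriodPair} {F G : CuspForm (Gamma0 N) k}

/-- **The local parameter `z(q)` along the modular parametrisation, with its logarithm AND its
`x`-coordinate.** Under the hypotheses of `exists_formalLog_subst_eq` (`f ≠ 0`, `Λ(L) ⊇ Λ_f`,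
`g₂(L) = −4a₄`, `g₃(L) = −4a₆`, `(F, G)` a presentation of `x = ℘_Λ(2πi∫f)`), there is ONE
`z ∈ qℂ⟦q⟧` with `z·y = −2x` in `ℂ((q))`, `log_E(z) = Σₙ aₙ(f)qⁿ/n`, and
`q-exp(G)·X_E(z) = z²·q-exp(F)` for `E : Y² = X³ + a₄X + a₆` — the `x`-coordinate of the formal
point of parameter `z(q)` is `x = q-exp(F)/q-exp(G)`. [cite: Honda1970, §6.2 (pp. 241–242)]
[cite: CremonaAlgorithms1997, §2.10] -/
theorem exists_formalLog_subst_eq_and_formalXMulSq (h : IsXPresentation f L F G) (hf : f ≠ 0) {a₄ a₆ : ℂ}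
    (h₂ : L.g₂ = -4 * a₄) (h₃ : L.g₃ = -4 * a₆) :
    ∃ z : ℂ⟦X⟧, constantCoeff z = 0 ∧
      (z : LaurentSeries ℂ) * ((h.yFn hf : modularFunctionField N) : LaurentSeries ℂ) =
        -2 * ((h.xFn : modularFunctionField N) : LaurentSeries ℂ) ∧
      ({ a₁ := 0, a₂ := 0, a₃ := 0, a₄ := a₄, a₆ := a₆ } : WeierstrassCurve ℂ).formalLog.subst z =
        (PowerSeries.mk fun n ↦ cuspCoeff f n / n) ∧
      qExpansion 1 (⇑G) *
          ({ a₁ := 0, a₂ := 0, a₃ := 0, a₄ := a₄, a₆ := a₆ } : WeierstrassCurve ℂ).formalXMulSq.subst z =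
        z ^ 2 * qExpansion 1 (⇑F) := by
  set a := qExpansion 1 (⇑F) with ha
  set b := qExpansion 1 (⇑G) with hb
  set e := qExpansion 1 (⇑f) with he
  have hF0 : (F : ModularForm (Gamma0 N) k) ≠ 0 := h.numerator_ne_zero hf
  have hG0 := h.modularForm_ne_zero
  have hf' : (f : ModularForm (Gamma0 N) 2) ≠ 0 := by
    intro h0; apply hf; apply DFunLike.ext; intro τ; exact DFunLike.congr_fun h0 τ
  have ha0 : a ≠ 0 := qExpansion_ne_zero_of_ne_zero hF0
  have hb0 : b ≠ 0 := qExpansion_ne_zero_of_ne_zero hG0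
  have he0 : e ≠ 0 := qExpansion_ne_zero_of_ne_zero hf'
  have hac : constantCoeff a = 0 := by
    rw [← coeff_zero_eq_constantCoeff_apply, ha]
    exact CuspFormClass.qExpansion_coeff_zero F one_pos (one_mem_strictPeriods_coe_gamma0 N)
  have hec : constantCoeff e = 0 := by
    rw [← coeff_zero_eq_constantCoeff_apply, he]
    exact CuspFormClass.qExpansion_coeff_zero f one_pos (one_mem_strictPeriods_coe_gamma0 N)
  have hord : a.order.toNat < b.order.toNat := h.qOrder_lt hf
  have hode : (b * thetaPS a - a * thetaPS b) ^ 2 =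
      4 * e ^ 2 * b * (a ^ 3 + C a₄ * a * b ^ 2 + C a₆ * b ^ 3) := by
    have h0 := h.odePS_eq_zero hf
    rw [h₂, h₃, map_mul, map_mul, map_neg, map_ofNat] at h0
    rw [← ha, ← hb, ← he] at h0
    linear_combination h0
  obtain ⟨z, hz⟩ := exists_mul_wronskian_eq e ha0 hb0 hord
  obtain ⟨hz0, hlog⟩ := formalLog_subst_eq_of_ode a₄ a₆ ha0 hb0 he0 hac hec hord hode hz
  have hX := mul_formalXMulSq_subst_eq_of_ode a₄ a₆ ha0 hb0 he0 hac hec hord hode hz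
  refine ⟨z, hz0, ?_, ?_, hX⟩
  · -- the Laurent identity `z·y = −2x`
    have hbL : ((b : ℂ⟦X⟧) : LaurentSeries ℂ) ≠ 0 := fun h0 ↦
      hb0 (HahnSeries.ofPowerSeries_injective (Γ := ℤ) (R := ℂ) (h0.trans (map_zero _).symm))
    have heL : ((e : ℂ⟦X⟧) : LaurentSeries ℂ) ≠ 0 := fun h0 ↦
      he0 (HahnSeries.ofPowerSeries_injective (Γ := ℤ) (R := ℂ) (h0.trans (map_zero _).symm))
    have hD0 : b * thetaPS a - a * thetaPS b ≠ 0 := by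
      intro h0
      rw [h0, mul_zero] at hz
      have htwo : (2 : ℂ⟦X⟧) ≠ 0 := by
        intro h
        have := congrArg constantCoeff h
        rw [map_ofNat, map_zero] at this
        norm_num at this
      exact mul_ne_zero (mul_ne_zero (mul_ne_zero (neg_ne_zero.mpr htwo) ha0) hb0) he0 hz.symm
    have hDL : ((b * thetaPS a - a * thetaPS b : ℂ⟦X⟧) : LaurentSeries ℂ) ≠ 0 := fun h0 ↦
      hD0 (HahnSeries.ofPowerSeries_injective (Γ := ℤ) (R := ℂ) (h0.trans (map_zero _).symm))
    have hzL : ((z : ℂ⟦X⟧) : LaurentSeries ℂ) * ((b * thetaPS a - a * thetaPS b : ℂ⟦X⟧) : LaurentSeries ℂ) =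
        -2 * (a : LaurentSeries ℂ) * (b : LaurentSeries ℂ) * (e : LaurentSeries ℂ) := by
      rw [← PowerSeries.coe_mul, hz]
      simp only [PowerSeries.coe_mul, PowerSeries.coe_neg, map_ofNat]
    have hx : ((h.xFn : modularFunctionField N) : LaurentSeries ℂ) =
        (a : LaurentSeries ℂ) / (b : LaurentSeries ℂ) := rfl
    rw [h.coe_yFn hf, hx, ← ha, ← hb, ← he, PowerSeries.coe_mul, PowerSeries.coe_mul,
      mul_div_assoc']
    rw [div_eq_iff (mul_ne_zero (mul_ne_zero hbL hbL) heL), hzL]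
    field_simp
  · rw [hlog]
    rfl

end IsXPresentation

end Modular

end Literature.NumberTheory.EllipticCurves.ModularForms
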